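import Summits.BirchSwinnertonDyer.BirchSwinnertonDyer.Theorems.AdditiveBranchIMCGordTwoRankZeroDesc3Door
import Summits.BirchSwinnertonDyer.Rank1Residual.Supersingular.CountPointsFast
import Summits.BirchSwinnertonDyer.Rank1Residual.Supersingular.IntModelMinimalityKrausTwoMore
import Summits.BirchSwinnertonDyer.Rank1Residual.X11b.KrausMinimalityGeneralTwo
import Summits.BirchSwinnertonDyer.Rank1Residual.SecondDescent.X10aPrimeTargetsKernelCertificates
import Summits.BirchSwinnertonDyer.Rank1Residual.Additive.X3RankZeroSemistableTwistOdd
import Summits.BirchSwinnertonDyer.Rank1Residual.Additive.X3RankZeroSemistableTwist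
import Summits.BirchSwinnertonDyer.Rank1Residual.Additive.JValuationOfIntModel
import Summits.BirchSwinnertonDyer.Rank1Residual.Partition.EisensteinKernelCertificate
import Summits.BirchSwinnertonDyer.Rank1Residual.Partition.EisensteinKernelAbscissa
import Summits.BirchSwinnertonDyer.Rank1Residual.Additive.RationalLineOfKernelPolynomial
import Summits.BirchSwinnertonDyer.Rank1Residual.Additive.X3LineDatumFiveRecordsPrototype
import Literature.NumberTheory.EllipticCurves.Rank1Residual.Typed.CasselsLowerBound
import Literature.NumberTheory.EllipticCurves.Rank1Residual.GVParityTwistProofs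
import HarnessLib

/-!
# Route `AdditiveBranchIMC` (rung K1, cell `bsd-addord`), crux `GordTwoRankZeroOffCaseOne` (item stmt-BirchSwinnertonDyer-19357),
# registered stub `stub_reducibleNoCaseOne` — ISOGENY-DESCENT RECORDS 11: the LOWER half `MissingLowerBoundAt W p`
# (`ord_p #Ш_an ≤ ord_p #Ш`) on REDUCIBLE content rows of cell (G-ord, `e = 2`) ∩ `r_an = 0` ∩ `ord_p #Ш_an = 2` from TWO
# `p`-isogeny-descent engines of different method (a `--supports stmt-BirchSwinnertonDyer-19357 --as helper` file; seat
# `bsd-addord-k1-c2x` (lane B), gen 6)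

HONEST FRAMING. Per-row instances of the crux's conclusion on rows of `stub_reducibleNoCaseOne`'s domain (`r_an = 0`,
`N10.CellGordTwo W p`, `W[p]` REDUCIBLE); nothing here proves BSD, the stub or the crux (OPEN at class level: the off-Case-1
reducible rows are Greenberg–Vatsal μ-territory, no printed `⊆(𝓛)` on the ramified `ω^{(p−1)/2}` branch); THEOREMS ONLY (no
definition, no named fact, no `sorry`); LOWER half only — no upper-half door exists on these rows, so nothing here is a `BSDp`
record and nothing is booked (booking is referee A's). Rows in this file: `397620h1` @ 3, `397620m1` @ 3, `402534h1` @ 3.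

ROAD (nobody's before: lane A's companion / DESC3 roads and gen 5's Kurihara road need `ρ̄_{E,p}` irreducible resp. onto;
cell `bsd-litref`'s RESISO production ran the same engines on the `#Ш_an`-UNIT reducible rows only, to certify `Ш[p] = 0`):
for a rational `p`-isogeny `φ : E → Ê = E/C` the `φ`-Selmer group `Sel^φ(E/ℚ) ⊂ H¹(ℚ, E[φ])` is computed EXACTLY by two engines
of cell `b2b-bsdres` / `bsd-litref` (byte-identical production bundle `pub/bsd-litref/lw16/eng/lw16desc-prod-pv/`):
engine 1 = `isogchi.gp` (sha16 `42175383589206a2`; Miller-function Kummer map into the `χ`-eigenspace of `L(S,p)`, `L = ℚ(C)`,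
S-units certified by `bnfcertify`, local images sampled to their exact Schaefer size) = kit j292739; engine 2 = `isogcft.gp`
(sha16 `0e36e3a0a15125b0`; class-field-theoretic dual computation with its own duality check) = kit j292741; both on Cremona's curve 1 of the
class, FIELD-IDENTICAL on (`[L:ℚ]`, `χ(σ)`, `ŝ = dim Sel^φ̂(Ê)`, `s_φ = dim Sel^φ(E)`, `m`, EXCESS), `bnfcertify = 1` on both sides
in both engines (litref rules K2/K3). READING (rank `0` by GZK from the displayed `r_an = 0`; `E(ℚ)[p] = 0` on every row):
`Ш(E)[φ] ≅ Sel^φ(E) / (Ê(ℚ)/φE(ℚ))`, the Mordell–Weil term being `0` (`Ê(ℚ)[φ̂] = 0`, rows with `m = 0`) or `1`-dimensional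
(`Ê(ℚ)[φ̂] = Ĉ(ℚ) ≅ ℤ/3`, the `3B.1.2` rows with `m = 1`); on every row of this file `dim_𝔽ₚ Ш(E)[φ] = 1`, so `Ш(E)[p] ⊇ Ш(E)[φ] ≠ 0`
— the displayed certificate binder `hx : ∃ x ∈ Ш(E), x ≠ 0, p•x = 0` (X1 `IsogenousDescentDisplay…` precedent). DOOR (class-free,
cell `b2b-bsdres`): `Typed.missingLowerBoundAt_of_casselsTate_of_pow_dvd` — `p ∣ #Ш` (`dvd_shaOrder_of_exists_torsion`), `Ш` finite
(GZK `hGZK` at `r_an = 0`), `#Ш` a square (Cassels–Tate `hCT`) ⟹ `p² ∣ #Ш`, i.e. `ord_p #Ш_an = 2 ≤ ord_p #Ш`.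

IN THE KERNEL per record (`decide` / `norm_num` on Cremona's coefficients): `Δ ≠ 0`; global minimality of the literal model `W`
and of its good ordinary twist model `V = W^{(p*)}` (Kraus); `W[p]` REDUCIBLE (`p = 3`: a rational root `x₀` of `Ψ₃`;
`p = 5`: the kernel-polynomial certificate `preΨ'₅ = h·q`, doubling closure, `2` generates `𝔽₅ˣ` — `KernelPolyLine`); the cell
`N10.CellGordTwo W p` (`Addv W p` from `p ∣ Δ`, `p ∣ c₄`; `TypeGOrd W p` from the explicit isomorphism `C • V^{(p*)} = W` with `V`
good ORDINARY at `p` by its `𝔽_p`-point count and `ord_p j ≥ 0`; `e = 12/gcd(12, ord_p Δ_min) = 2` from `ord_p Δ = 6`).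
DISPLAYED binders: the register facts `hCT`, `hGZK`; Cremona's `r_an = 0` (`hr0`) and `#Ш_an = q`, `ord_p q ≤ 2` (`hq`, `hv`; value
quoted per record); the certificate `hx` (EVIDENCE quoted per record from the two kit jobs; fold table `CERTS-k1c2x-g6.tsv` on the item).
References: [SilvermanAEC2009] Thm. X.4.14, X.4.2, Ex. 3.7, VII.1 Rem. 1.1, VII.5 Prop. 5.1; [Cassels1965ArithmeticVIII];
[SchaeferStoll2004] (descent via isogeny; local image sizes: Schaefer, J. Number Theory 56 (1996) Lemma 3.8); [MilneADT2006] I.7;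
[GreenbergVatsal2000] §2 p. 28 (the off-Case-1 lines); [Miller2011LMS] Def. 1.1; [Kraus1989]; [Cremona1997] Table 1, §3.8.
-/

set_option autoImplicit false
set_option linter.dupNamespace false

noncomputable section

open scoped Classical

open WeierstrassCurve Polynomial Literature.NumberTheory.EllipticCurves
  Literature.NumberTheory.EllipticCurves.Rank1Residual
  Literature.NumberTheory.EllipticCurves.Rank1Residual.Typed
  Literature.NumberTheory.EllipticCurves.Rank1Residual.X11RankOneCertificates
  Literature.NumberTheory.GaloisRepresentations
  Summit.BirchSwinnertonDyer.BirchSwinnertonDyer.Rank1Residual.IntModel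
  Summit.BirchSwinnertonDyer.BirchSwinnertonDyer.Rank1Residual.X11RankOne
  Summit.BirchSwinnertonDyer.Rank1Residual
  Summit.BirchSwinnertonDyer.Rank1Residual.X11b
  Summit.BirchSwinnertonDyer.Rank1Residual.Supersingular
  Summit.BirchSwinnertonDyer.Rank1Residual.SecondDescent
  Summit.BirchSwinnertonDyer.Rank1Residual.Additive

namespace Summit.BirchSwinnertonDyer.BirchSwinnertonDyer.Theorems.AdditiveBranchIMCGordTwoRankZeroIsogenyDescent

/-! ### `397620h1` (class `397620h`, `N = 397620 = 2^2·3^2·5·47^2`; members: 397620h1 `#Ш_an = 9`, `#tors = 1`, `∏c = 4`, 397620h2 `#Ш_an = 9`, `#tors = 1`, `∏c = 12`; image `3B`) -/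

/-- `[0, 0, 0, -140684583, 641093112718]` (Cremona's minimal model of `397620h1`) is an elliptic curve: `Δ = 2^8·3^6·5^5·47^9 ≠ 0`. [cite: Cremona1997, Table 1] -/
theorem isElliptic_i397620h1 : (⟨0, 0, 0, -140684583, 641093112718⟩ : WeierstrassCurve ℚ).IsElliptic :=
  isElliptic_of_discOf_ne_zero 0 0 0 (-140684583) 641093112718 (by decide +kernel)

/-- `[0, 0, 0, -140684583, 641093112718]` (`397620h1`) is globally minimal (bounded Kraus form, kernel; `|Δ| = 2^8·3^6·5^5·47^9`). [cite: SilvermanAEC2009, VII.1 Remark 1.1] [cite: Kraus1989, Prop. 1 and Prop. 2] -/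
theorem isGloballyMinimal_i397620h1 : (⟨0, 0, 0, -140684583, 641093112718⟩ : WeierstrassCurve ℚ).IsGloballyMinimal :=
  isGloballyMinimal_of_krausCriterion_bounded 0 0 0 (-140684583) 641093112718
      (by decide +kernel) (by decide +kernel) (by decide +kernel)

/-- `[0, 1, 0, -15631620, -23749399900]` (the good ordinary twist model `V = 397620h1^{(-3)}`, conductor `44180`) is an elliptic curve: `Δ ≠ 0` (kernel). [cite: SilvermanAEC2009, III.1] -/
theorem isElliptic_iV397620h1 : (⟨0, 1, 0, -15631620, -23749399900⟩ : WeierstrassCurve ℚ).IsElliptic :=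
  isElliptic_of_discOf_ne_zero 0 1 0 (-15631620) (-23749399900) (by decide +kernel)

/-- `[0, 1, 0, -15631620, -23749399900]` (twist model `V` of `397620h1`) is globally minimal (bounded Kraus form, kernel). [cite: SilvermanAEC2009, VII.1 Remark 1.1] [cite: Kraus1989, Prop. 1 and Prop. 2] -/
theorem isGloballyMinimal_iV397620h1 : (⟨0, 1, 0, -15631620, -23749399900⟩ : WeierstrassCurve ℚ).IsGloballyMinimal :=
  isGloballyMinimal_of_krausCriterion_bounded 0 1 0 (-15631620) (-23749399900)
    (by decide +kernel) (by decide +kernel) (by decide +kernel)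

/-- **`V = [0, 1, 0, -15631620, -23749399900]` has good ORDINARY reduction at `3`** (kernel: `3 ∤ Δ(V)`, `#Ṽ(𝔽_3) = 3`, `a_3 = 1 ≢ 0 (mod 3)`). [cite: SilvermanAEC2009, VII.5 Prop. 5.1(a)] -/
theorem goodOrd3_iV397620h1 : haveI := isGloballyMinimal_iV397620h1; GoodOrd (⟨0, 1, 0, -15631620, -23749399900⟩ : WeierstrassCurve ℚ) 3 := by
  haveI := isGloballyMinimal_iV397620h1
  haveI : Fact (Nat.Prime 3) := ⟨by norm_num⟩
  have hI : integralModelInt (⟨0, 1, 0, -15631620, -23749399900⟩ : WeierstrassCurve ℚ) = (⟨0, 1, 0, -15631620, -23749399900⟩ : WeierstrassCurve ℤ) :=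
    integralModelInt_eq_of_map_eq _ (map_mk_int 0 1 0 (-15631620) (-23749399900))
  have hc : Nat.card (((⟨0, 1, 0, -15631620, -23749399900⟩ : WeierstrassCurve ℤ).map (Int.castRingHom (ZMod 3))).toAffine.Point) = 3 := by
    have h := natCard_point_eq_countPoints 0 1 0 (-15631620) (-23749399900) 3 (by norm_num) (by decide +kernel)
    have h' : countPoints [0, 1, 0, -15631620, -23749399900] 3 = 3 := by decide +kernel
    exact_mod_cast h.trans h'
  exact SecondDescent.goodOrd_of_intModel 3 hI (by decide +kernel) hc (by decide)

/-- **`397620h1[3]` is REDUCIBLE — IN THE KERNEL**: `x₀ = 7943` is a rational root of `Ψ₃` (the kernel polynomial `h = x - 7943` of the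
rational `3`-isogeny `397620h1 → 397620h2`, as found by both engines). [cite: SilvermanAEC2009, Ex. 3.7] -/
theorem not_irreducible_i397620h1 : ¬ (⟨0, 0, 0, -140684583, 641093112718⟩ : WeierstrassCurve ℚ).HasIrreducibleModPGaloisRep 3 := by
  haveI := isElliptic_i397620h1
  have hψ : (⟨0, 0, 0, -140684583, 641093112718⟩ : WeierstrassCurve ℚ).Ψ₃.eval (7943 : ℚ) = 0 := by
    norm_num [WeierstrassCurve.Ψ₃, WeierstrassCurve.b₂, WeierstrassCurve.b₄, WeierstrassCurve.b₆, WeierstrassCurve.b₈]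
  obtain ⟨Φ, P, y, h, hΦ, -⟩ :=
    KernelDisc.exists_isRationalLine_of_eval_Ψ₃_eq_zero (W := (⟨0, 0, 0, -140684583, 641093112718⟩ : WeierstrassCurve ℚ)) _ hψ
      (KernelDisc.eval_Ψ₂Sq_ne_zero_of_eval_Ψ₃ hψ)
  exact not_hasIrreducibleModPGaloisRep_of_isRationalLine hΦ

/-- **Row `397620h1` @ `3` of crux 19357's stub `stub_reducibleNoCaseOne`: the row lies in the stub's domain — cell (G-ord, `e = 2`) `N10.CellGordTwo W 3`
and `W[3]` REDUCIBLE, both IN THE KERNEL — and the stub's conclusion L₀ = `ord_3 #Ш_an ≤ ord_3 #Ш` holds for it** (Cremona `397620h1` = `[0, 0, 0, -140684583, 641093112718]`,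
`N = 397620 = 2^2·3^2·5·47^2`, `r_an = 0`, `#Ш_an = 9`, `#E(ℚ)_tors = 1`, `∏ c_ℓ = 4`; class `397620h` of 2 curves, `3² ∣ #Ш_an` on every member).
KERNEL: `Addv W 3` (`3 ∣ Δ`, `3 ∣ c₄`), `ord_3 j ≥ 0` (`3² ∣ c₄`, `3⁷ ∤ Δ`), the isomorphism `⟨1, 1, 0, 0⟩ • V^{(-3)} = W` with
`V = [0, 1, 0, -15631620, -23749399900]` good ordinary at `3` (`#Ṽ(𝔽_3) = 3`) ⟹ `TypeGOrd W 3`; `e = 12/gcd(12, ord_3 Δ_min) = 2` (`ord_3 Δ = 6`, Kodaira I₀*); reducibility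
(`not_irreducible_i397620h1`). DISPLAYED: `hCT` (Cassels–Tate), `hGZK`; `hr0`, `hq`/`hv` (`#Ш_an = 9`, `ord_3 = 2`); the certificate
`hx : Ш(W)[3] ≠ 0` — EVIDENCE (3-isogeny descent, kernel `C`: `h = x - 7943`, `[ℚ(C):ℚ] = 2`, `χ(σ) = 2`, `Ê = 397620h2 = [0,0,0,-626576223,-5455658403578]`, `S = [2,3,5,47]`):
engine 1 `isogchi.gp` kit j292739 and engine 2 `isogcft.gp` kit j292741 AGREE on `ŝ = dim Sel^φ̂(Ê) = 1`, `s_φ = dim Sel^φ(W) = 1`, `m = 0`, EXCESS `= 2`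
(`bnfcertify` 1/1 / 1/1, isogcft duality PASS/PASS); Mordell–Weil part of `Sel^φ(W)` = `0` (`#W(ℚ)_tors = 1`, `#Ê(ℚ)_tors = 1` — no rational `3`-torsion on either side (Cremona), rank `0`: `Ê(ℚ)/φW(ℚ) = 0`) ⟹ **`dim Ш(W)[φ] = 1`**, `Ш(W)[3] ⊇ Ш(W)[φ] ≠ 0`.
LOWER half only; per row; NOT a class theorem; nothing booked; BSD is not proved by any of this.
[cite: SilvermanAEC2009, Thm. X.4.14 and Ex. 3.7] [cite: SchaeferStoll2004] [cite: Cremona1997, Table 1 (label 397620h1)] [cite: Miller2011LMS, Def. 1.1] -/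
theorem gordTwoLower_isog_i397620h1_3
    (hCT : exists_casselsTate_pairing (K := ℚ)) (hGZK : rank_eq_analyticRank_of_analyticRank_le_one)
    {W : WeierstrassCurve ℚ} [W.IsElliptic] [W.IsGloballyMinimal] (hWeq : W = ⟨0, 0, 0, -140684583, 641093112718⟩)
    (hr0 : W.analyticRank = 0) {q : ℚ} (hq : shaAn W = (q : ℂ)) (hv : padicValRat 3 q ≤ 2)
    (hx : ∃ x : W.sha, x ≠ 0 ∧ 3 • x = 0) :
    N10.CellGordTwo W 3 ∧ ¬ W.HasIrreducibleModPGaloisRep 3 ∧ MissingLowerBoundAt W 3 := by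
  haveI : Fact (Nat.Prime 3) := ⟨by norm_num⟩
  haveI := isElliptic_iV397620h1
  haveI := isGloballyMinimal_iV397620h1
  have hIW : integralModelInt W = (⟨0, 0, 0, -140684583, 641093112718⟩ : WeierstrassCurve ℤ) :=
    integralModelInt_eq_of_map_eq _ (by rw [hWeq]; ext <;> simp [WeierstrassCurve.map])
  have hadd : Addv W 3 := Additive.addv_of_intModel hIW 3 (by decide +kernel) (by decide +kernel)
  have hj : 0 ≤ padicValRat 3 W.j := padicValRat_j_nonneg_of_intModel hIW 3 2 (by decide +kernel) (by decide +kernel)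
  have hWV : (⟨1, (1 : ℚ), (0 : ℚ), (0 : ℚ)⟩ : VariableChange ℚ) • (⟨0, 1, 0, -15631620, -23749399900⟩ : WeierstrassCurve ℚ).quadraticTwist (-((3 : ℕ) : ℚ)) = W := by
    rw [hWeq]
    ext <;> simp [WeierstrassCurve.variableChange_a₁, WeierstrassCurve.variableChange_a₂,
      WeierstrassCurve.variableChange_a₃, WeierstrassCurve.variableChange_a₄, WeierstrassCurve.variableChange_a₆,
      WeierstrassCurve.quadraticTwist, WeierstrassCurve.b₂, WeierstrassCurve.b₄, WeierstrassCurve.b₆] <;> norm_num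
  have hG : TypeGOrd W 3 :=
    (typeGOrd_or_padicValRat_j_neg_of_twist_neg W 3 (by norm_num) (⟨0, 1, 0, -15631620, -23749399900⟩ : WeierstrassCurve ℚ) ⟨_, hWV⟩
      (Or.inl goodOrd3_iV397620h1)).resolve_right (not_lt.mpr hj)
  have he : semistabilityIndex W 3 = 2 := by
    rw [semistabilityIndex, minimalDiscriminantInt_eq hIW, intCurve_Δ]; decide +kernel
  have hred : ¬ W.HasIrreducibleModPGaloisRep 3 := by rw [hWeq]; exact not_irreducible_i397620h1
  exact ⟨⟨by norm_num, hadd, hG, he⟩, hred,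
    missingLowerBoundAt_of_casselsTate_of_pow_dvd W 3 hCT (hGZK W (by rw [hr0]; norm_num)).2 hq (k := 1)
      (by simpa using hv) (by simpa using dvd_shaOrder_of_exists_torsion W 3 hx)⟩

/-- **L₀ = `ord_3 #Ш_an ≤ ord_3 #Ш` for `397620h1`** — the crux's conclusion `MissingLowerBoundAt W 3` on this `stub_reducibleNoCaseOne` row, from
`gordTwoLower_isog_i397620h1_3` (same binders). Per row; nothing booked. [cite: SilvermanAEC2009, Thm. X.4.14] [cite: Miller2011LMS, Def. 1.1] -/
theorem missingLowerBoundAt_i397620h1_3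
    (hCT : exists_casselsTate_pairing (K := ℚ)) (hGZK : rank_eq_analyticRank_of_analyticRank_le_one)
    {W : WeierstrassCurve ℚ} [W.IsElliptic] [W.IsGloballyMinimal] (hWeq : W = ⟨0, 0, 0, -140684583, 641093112718⟩)
    (hr0 : W.analyticRank = 0) {q : ℚ} (hq : shaAn W = (q : ℂ)) (hv : padicValRat 3 q ≤ 2)
    (hx : ∃ x : W.sha, x ≠ 0 ∧ 3 • x = 0) : MissingLowerBoundAt W 3 :=
  (gordTwoLower_isog_i397620h1_3 hCT hGZK hWeq hr0 hq hv hx).2.2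

/-! ### `397620m1` (class `397620m`, `N = 397620 = 2^2·3^2·5·47^2`; members: 397620m1 `#Ш_an = 9`, `#tors = 2`, `∏c = 4`, 397620m2 `#Ш_an = 9`, `#tors = 2`, `∏c = 8`, 397620m3 `#Ш_an = 9`, `#tors = 2`, `∏c = 12`, 397620m4 `#Ш_an = 9`, `#tors = 2`, `∏c = 24`; image `2B 3B`) -/

/-- `[0, 0, 0, -26508, 1142053]` (Cremona's minimal model of `397620m1`) is an elliptic curve: `Δ = 2^4·3^6·5·47^6 ≠ 0`. [cite: Cremona1997, Table 1] -/
theorem isElliptic_i397620m1 : (⟨0, 0, 0, -26508, 1142053⟩ : WeierstrassCurve ℚ).IsElliptic :=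
  isElliptic_of_discOf_ne_zero 0 0 0 (-26508) 1142053 (by decide +kernel)

/-- `[0, 0, 0, -26508, 1142053]` (`397620m1`) is globally minimal (bounded Kraus form, kernel; `|Δ| = 2^4·3^6·5·47^6`). [cite: SilvermanAEC2009, VII.1 Remark 1.1] [cite: Kraus1989, Prop. 1 and Prop. 2] -/
theorem isGloballyMinimal_i397620m1 : (⟨0, 0, 0, -26508, 1142053⟩ : WeierstrassCurve ℚ).IsGloballyMinimal :=
  isGloballyMinimal_of_krausCriterion_bounded 0 0 0 (-26508) 1142053
      (by decide +kernel) (by decide +kernel) (by decide +kernel)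

/-- `[0, 1, 0, -2945, -43280]` (the good ordinary twist model `V = 397620m1^{(-3)}`, conductor `44180`) is an elliptic curve: `Δ ≠ 0` (kernel). [cite: SilvermanAEC2009, III.1] -/
theorem isElliptic_iV397620m1 : (⟨0, 1, 0, -2945, -43280⟩ : WeierstrassCurve ℚ).IsElliptic :=
  isElliptic_of_discOf_ne_zero 0 1 0 (-2945) (-43280) (by decide +kernel)

/-- `[0, 1, 0, -2945, -43280]` (twist model `V` of `397620m1`) is globally minimal (bounded Kraus form, kernel). [cite: SilvermanAEC2009, VII.1 Remark 1.1] [cite: Kraus1989, Prop. 1 and Prop. 2] -/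
theorem isGloballyMinimal_iV397620m1 : (⟨0, 1, 0, -2945, -43280⟩ : WeierstrassCurve ℚ).IsGloballyMinimal :=
  isGloballyMinimal_of_krausCriterion_bounded 0 1 0 (-2945) (-43280)
    (by decide +kernel) (by decide +kernel) (by decide +kernel)

/-- **`V = [0, 1, 0, -2945, -43280]` has good ORDINARY reduction at `3`** (kernel: `3 ∤ Δ(V)`, `#Ṽ(𝔽_3) = 6`, `a_3 = -2 ≢ 0 (mod 3)`). [cite: SilvermanAEC2009, VII.5 Prop. 5.1(a)] -/
theorem goodOrd3_iV397620m1 : haveI := isGloballyMinimal_iV397620m1; GoodOrd (⟨0, 1, 0, -2945, -43280⟩ : WeierstrassCurve ℚ) 3 := by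
  haveI := isGloballyMinimal_iV397620m1
  haveI : Fact (Nat.Prime 3) := ⟨by norm_num⟩
  have hI : integralModelInt (⟨0, 1, 0, -2945, -43280⟩ : WeierstrassCurve ℚ) = (⟨0, 1, 0, -2945, -43280⟩ : WeierstrassCurve ℤ) :=
    integralModelInt_eq_of_map_eq _ (map_mk_int 0 1 0 (-2945) (-43280))
  have hc : Nat.card (((⟨0, 1, 0, -2945, -43280⟩ : WeierstrassCurve ℤ).map (Int.castRingHom (ZMod 3))).toAffine.Point) = 6 := by
    have h := natCard_point_eq_countPoints 0 1 0 (-2945) (-43280) 3 (by norm_num) (by decide +kernel)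
    have h' : countPoints [0, 1, 0, -2945, -43280] 3 = 6 := by decide +kernel
    exact_mod_cast h.trans h'
  exact SecondDescent.goodOrd_of_intModel 3 hI (by decide +kernel) hc (by decide)

/-- **`397620m1[3]` is REDUCIBLE — IN THE KERNEL**: `x₀ = 188` is a rational root of `Ψ₃` (the kernel polynomial `h = x - 188` of the
rational `3`-isogeny `397620m1 → 397620m3`, as found by both engines). [cite: SilvermanAEC2009, Ex. 3.7] -/
theorem not_irreducible_i397620m1 : ¬ (⟨0, 0, 0, -26508, 1142053⟩ : WeierstrassCurve ℚ).HasIrreducibleModPGaloisRep 3 := by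
  haveI := isElliptic_i397620m1
  have hψ : (⟨0, 0, 0, -26508, 1142053⟩ : WeierstrassCurve ℚ).Ψ₃.eval (188 : ℚ) = 0 := by
    norm_num [WeierstrassCurve.Ψ₃, WeierstrassCurve.b₂, WeierstrassCurve.b₄, WeierstrassCurve.b₆, WeierstrassCurve.b₈]
  obtain ⟨Φ, P, y, h, hΦ, -⟩ :=
    KernelDisc.exists_isRationalLine_of_eval_Ψ₃_eq_zero (W := (⟨0, 0, 0, -26508, 1142053⟩ : WeierstrassCurve ℚ)) _ hψ
      (KernelDisc.eval_Ψ₂Sq_ne_zero_of_eval_Ψ₃ hψ)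
  exact not_hasIrreducibleModPGaloisRep_of_isRationalLine hΦ

/-- **Row `397620m1` @ `3` of crux 19357's stub `stub_reducibleNoCaseOne`: the row lies in the stub's domain — cell (G-ord, `e = 2`) `N10.CellGordTwo W 3`
and `W[3]` REDUCIBLE, both IN THE KERNEL — and the stub's conclusion L₀ = `ord_3 #Ш_an ≤ ord_3 #Ш` holds for it** (Cremona `397620m1` = `[0, 0, 0, -26508, 1142053]`,
`N = 397620 = 2^2·3^2·5·47^2`, `r_an = 0`, `#Ш_an = 9`, `#E(ℚ)_tors = 2`, `∏ c_ℓ = 4`; class `397620m` of 4 curves, `3² ∣ #Ш_an` on every member).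
KERNEL: `Addv W 3` (`3 ∣ Δ`, `3 ∣ c₄`), `ord_3 j ≥ 0` (`3² ∣ c₄`, `3⁷ ∤ Δ`), the isomorphism `⟨1, 1, 0, 0⟩ • V^{(-3)} = W` with
`V = [0, 1, 0, -2945, -43280]` good ordinary at `3` (`#Ṽ(𝔽_3) = 6`) ⟹ `TypeGOrd W 3`; `e = 12/gcd(12, ord_3 Δ_min) = 2` (`ord_3 Δ = 6`, Kodaira I₀*); reducibility
(`not_irreducible_i397620m1`). DISPLAYED: `hCT` (Cassels–Tate), `hGZK`; `hr0`, `hq`/`hv` (`#Ш_an = 9`, `ord_3 = 2`); the certificate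
`hx : Ш(W)[3] ≠ 0` — EVIDENCE (3-isogeny descent, kernel `C`: `h = x - 188`, `[ℚ(C):ℚ] = 2`, `χ(σ) = 2`, `Ê = 397620m3 = [0,0,0,-821748,-286655303]`, `S = [2,3,5,47]`):
engine 1 `isogchi.gp` kit j292739 and engine 2 `isogcft.gp` kit j292741 AGREE on `ŝ = dim Sel^φ̂(Ê) = 1`, `s_φ = dim Sel^φ(W) = 1`, `m = 0`, EXCESS `= 2`
(`bnfcertify` 1/1 / 1/1, isogcft duality PASS/PASS); Mordell–Weil part of `Sel^φ(W)` = `0` (`#W(ℚ)_tors = 2`, `#Ê(ℚ)_tors = 2` — no rational `3`-torsion on either side (Cremona), rank `0`: `Ê(ℚ)/φW(ℚ) = 0`) ⟹ **`dim Ш(W)[φ] = 1`**, `Ш(W)[3] ⊇ Ш(W)[φ] ≠ 0`.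
LOWER half only; per row; NOT a class theorem; nothing booked; BSD is not proved by any of this.
[cite: SilvermanAEC2009, Thm. X.4.14 and Ex. 3.7] [cite: SchaeferStoll2004] [cite: Cremona1997, Table 1 (label 397620m1)] [cite: Miller2011LMS, Def. 1.1] -/
theorem gordTwoLower_isog_i397620m1_3
    (hCT : exists_casselsTate_pairing (K := ℚ)) (hGZK : rank_eq_analyticRank_of_analyticRank_le_one)
    {W : WeierstrassCurve ℚ} [W.IsElliptic] [W.IsGloballyMinimal] (hWeq : W = ⟨0, 0, 0, -26508, 1142053⟩)
    (hr0 : W.analyticRank = 0) {q : ℚ} (hq : shaAn W = (q : ℂ)) (hv : padicValRat 3 q ≤ 2)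
    (hx : ∃ x : W.sha, x ≠ 0 ∧ 3 • x = 0) :
    N10.CellGordTwo W 3 ∧ ¬ W.HasIrreducibleModPGaloisRep 3 ∧ MissingLowerBoundAt W 3 := by
  haveI : Fact (Nat.Prime 3) := ⟨by norm_num⟩
  haveI := isElliptic_iV397620m1
  haveI := isGloballyMinimal_iV397620m1
  have hIW : integralModelInt W = (⟨0, 0, 0, -26508, 1142053⟩ : WeierstrassCurve ℤ) :=
    integralModelInt_eq_of_map_eq _ (by rw [hWeq]; ext <;> simp [WeierstrassCurve.map])
  have hadd : Addv W 3 := Additive.addv_of_intModel hIW 3 (by decide +kernel) (by decide +kernel)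
  have hj : 0 ≤ padicValRat 3 W.j := padicValRat_j_nonneg_of_intModel hIW 3 2 (by decide +kernel) (by decide +kernel)
  have hWV : (⟨1, (1 : ℚ), (0 : ℚ), (0 : ℚ)⟩ : VariableChange ℚ) • (⟨0, 1, 0, -2945, -43280⟩ : WeierstrassCurve ℚ).quadraticTwist (-((3 : ℕ) : ℚ)) = W := by
    rw [hWeq]
    ext <;> simp [WeierstrassCurve.variableChange_a₁, WeierstrassCurve.variableChange_a₂,
      WeierstrassCurve.variableChange_a₃, WeierstrassCurve.variableChange_a₄, WeierstrassCurve.variableChange_a₆,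
      WeierstrassCurve.quadraticTwist, WeierstrassCurve.b₂, WeierstrassCurve.b₄, WeierstrassCurve.b₆] <;> norm_num
  have hG : TypeGOrd W 3 :=
    (typeGOrd_or_padicValRat_j_neg_of_twist_neg W 3 (by norm_num) (⟨0, 1, 0, -2945, -43280⟩ : WeierstrassCurve ℚ) ⟨_, hWV⟩
      (Or.inl goodOrd3_iV397620m1)).resolve_right (not_lt.mpr hj)
  have he : semistabilityIndex W 3 = 2 := by
    rw [semistabilityIndex, minimalDiscriminantInt_eq hIW, intCurve_Δ]; decide +kernel
  have hred : ¬ W.HasIrreducibleModPGaloisRep 3 := by rw [hWeq]; exact not_irreducible_i397620m1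
  exact ⟨⟨by norm_num, hadd, hG, he⟩, hred,
    missingLowerBoundAt_of_casselsTate_of_pow_dvd W 3 hCT (hGZK W (by rw [hr0]; norm_num)).2 hq (k := 1)
      (by simpa using hv) (by simpa using dvd_shaOrder_of_exists_torsion W 3 hx)⟩

/-- **L₀ = `ord_3 #Ш_an ≤ ord_3 #Ш` for `397620m1`** — the crux's conclusion `MissingLowerBoundAt W 3` on this `stub_reducibleNoCaseOne` row, from
`gordTwoLower_isog_i397620m1_3` (same binders). Per row; nothing booked. [cite: SilvermanAEC2009, Thm. X.4.14] [cite: Miller2011LMS, Def. 1.1] -/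
theorem missingLowerBoundAt_i397620m1_3
    (hCT : exists_casselsTate_pairing (K := ℚ)) (hGZK : rank_eq_analyticRank_of_analyticRank_le_one)
    {W : WeierstrassCurve ℚ} [W.IsElliptic] [W.IsGloballyMinimal] (hWeq : W = ⟨0, 0, 0, -26508, 1142053⟩)
    (hr0 : W.analyticRank = 0) {q : ℚ} (hq : shaAn W = (q : ℂ)) (hv : padicValRat 3 q ≤ 2)
    (hx : ∃ x : W.sha, x ≠ 0 ∧ 3 • x = 0) : MissingLowerBoundAt W 3 :=
  (gordTwoLower_isog_i397620m1_3 hCT hGZK hWeq hr0 hq hv hx).2.2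

/-! ### `402534h1` (class `402534h`, `N = 402534 = 2·3^2·11·19·107`; members: 402534h1 `#Ш_an = 9`, `#tors = 1`, `∏c = 1`, 402534h2 `#Ш_an = 9`, `#tors = 3`, `∏c = 9`; image `3B12`) -/

/-- `[1, -1, 0, 2322, -22572]` (Cremona's minimal model of `402534h1`) is an elliptic curve: `Δ = −2^9·3^6·11^3·19·107 ≠ 0`. [cite: Cremona1997, Table 1] -/
theorem isElliptic_i402534h1 : (⟨1, -1, 0, 2322, -22572⟩ : WeierstrassCurve ℚ).IsElliptic :=
  isElliptic_of_discOf_ne_zero 1 (-1) 0 2322 (-22572) (by decide +kernel)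

/-- `[1, -1, 0, 2322, -22572]` (`402534h1`) is globally minimal (bounded Kraus form, kernel; `|Δ| = 2^9·3^6·11^3·19·107`). [cite: SilvermanAEC2009, VII.1 Remark 1.1] [cite: Kraus1989, Prop. 1 and Prop. 2] -/
theorem isGloballyMinimal_i402534h1 : (⟨1, -1, 0, 2322, -22572⟩ : WeierstrassCurve ℚ).IsGloballyMinimal :=
  isGloballyMinimal_of_krausCriterion_bounded 1 (-1) 0 2322 (-22572)
      (by decide +kernel) (by decide +kernel) (by decide +kernel)

/-- `[1, 0, 0, 258, 836]` (the good ordinary twist model `V = 402534h1^{(-3)}`, conductor `44726`) is an elliptic curve: `Δ ≠ 0` (kernel). [cite: SilvermanAEC2009, III.1] -/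
theorem isElliptic_iV402534h1 : (⟨1, 0, 0, 258, 836⟩ : WeierstrassCurve ℚ).IsElliptic :=
  isElliptic_of_discOf_ne_zero 1 0 0 258 836 (by decide +kernel)

/-- `[1, 0, 0, 258, 836]` (twist model `V` of `402534h1`) is globally minimal (bounded Kraus form, kernel). [cite: SilvermanAEC2009, VII.1 Remark 1.1] [cite: Kraus1989, Prop. 1 and Prop. 2] -/
theorem isGloballyMinimal_iV402534h1 : (⟨1, 0, 0, 258, 836⟩ : WeierstrassCurve ℚ).IsGloballyMinimal :=
  isGloballyMinimal_of_krausCriterion_bounded 1 0 0 258 836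
    (by decide +kernel) (by decide +kernel) (by decide +kernel)

/-- **`V = [1, 0, 0, 258, 836]` has good ORDINARY reduction at `3`** (kernel: `3 ∤ Δ(V)`, `#Ṽ(𝔽_3) = 3`, `a_3 = 1 ≢ 0 (mod 3)`). [cite: SilvermanAEC2009, VII.5 Prop. 5.1(a)] -/
theorem goodOrd3_iV402534h1 : haveI := isGloballyMinimal_iV402534h1; GoodOrd (⟨1, 0, 0, 258, 836⟩ : WeierstrassCurve ℚ) 3 := by
  haveI := isGloballyMinimal_iV402534h1
  haveI : Fact (Nat.Prime 3) := ⟨by norm_num⟩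
  have hI : integralModelInt (⟨1, 0, 0, 258, 836⟩ : WeierstrassCurve ℚ) = (⟨1, 0, 0, 258, 836⟩ : WeierstrassCurve ℤ) :=
    integralModelInt_eq_of_map_eq _ (map_mk_int 1 0 0 258 836)
  have hc : Nat.card (((⟨1, 0, 0, 258, 836⟩ : WeierstrassCurve ℤ).map (Int.castRingHom (ZMod 3))).toAffine.Point) = 3 := by
    have h := natCard_point_eq_countPoints 1 0 0 258 836 3 (by norm_num) (by decide +kernel)
    have h' : countPoints [1, 0, 0, 258, 836] 3 = 3 := by decide +kernel
    exact_mod_cast h.trans h'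
  exact SecondDescent.goodOrd_of_intModel 3 hI (by decide +kernel) hc (by decide)

/-- **`402534h1[3]` is REDUCIBLE — IN THE KERNEL**: `x₀ = -12` is a rational root of `Ψ₃` (the kernel polynomial `h = x + 12` of the
rational `3`-isogeny `402534h1 → 402534h2`, as found by both engines). [cite: SilvermanAEC2009, Ex. 3.7] -/
theorem not_irreducible_i402534h1 : ¬ (⟨1, -1, 0, 2322, -22572⟩ : WeierstrassCurve ℚ).HasIrreducibleModPGaloisRep 3 := by
  haveI := isElliptic_i402534h1
  have hψ : (⟨1, -1, 0, 2322, -22572⟩ : WeierstrassCurve ℚ).Ψ₃.eval ((-12) : ℚ) = 0 := by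
    norm_num [WeierstrassCurve.Ψ₃, WeierstrassCurve.b₂, WeierstrassCurve.b₄, WeierstrassCurve.b₆, WeierstrassCurve.b₈]
  obtain ⟨Φ, P, y, h, hΦ, -⟩ :=
    KernelDisc.exists_isRationalLine_of_eval_Ψ₃_eq_zero (W := (⟨1, -1, 0, 2322, -22572⟩ : WeierstrassCurve ℚ)) _ hψ
      (KernelDisc.eval_Ψ₂Sq_ne_zero_of_eval_Ψ₃ hψ)
  exact not_hasIrreducibleModPGaloisRep_of_isRationalLine hΦ

/-- **Row `402534h1` @ `3` of crux 19357's stub `stub_reducibleNoCaseOne`: the row lies in the stub's domain — cell (G-ord, `e = 2`) `N10.CellGordTwo W 3`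
and `W[3]` REDUCIBLE, both IN THE KERNEL — and the stub's conclusion L₀ = `ord_3 #Ш_an ≤ ord_3 #Ш` holds for it** (Cremona `402534h1` = `[1, -1, 0, 2322, -22572]`,
`N = 402534 = 2·3^2·11·19·107`, `r_an = 0`, `#Ш_an = 9`, `#E(ℚ)_tors = 1`, `∏ c_ℓ = 1`; class `402534h` of 2 curves, `3² ∣ #Ш_an` on every member).
KERNEL: `Addv W 3` (`3 ∣ Δ`, `3 ∣ c₄`), `ord_3 j ≥ 0` (`3² ∣ c₄`, `3⁷ ∤ Δ`), the isomorphism `⟨1, 0, 1/2, 0⟩ • V^{(-3)} = W` with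
`V = [1, 0, 0, 258, 836]` good ordinary at `3` (`#Ṽ(𝔽_3) = 3`) ⟹ `TypeGOrd W 3`; `e = 12/gcd(12, ord_3 Δ_min) = 2` (`ord_3 Δ = 6`, Kodaira I₀*); reducibility
(`not_irreducible_i402534h1`). DISPLAYED: `hCT` (Cassels–Tate), `hGZK`; `hr0`, `hq`/`hv` (`#Ш_an = 9`, `ord_3 = 2`); the certificate
`hx : Ш(W)[3] ≠ 0` — EVIDENCE (3-isogeny descent, kernel `C`: `h = x + 12`, `[ℚ(C):ℚ] = 2`, `χ(σ) = 2`, `Ê = 402534h2 = [1,-1,0,-25398,1923372]`, `S = [2,3,11,19,107]`):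
engine 1 `isogchi.gp` kit j292739 and engine 2 `isogcft.gp` kit j292741 AGREE on `ŝ = dim Sel^φ̂(Ê) = 1`, `s_φ = dim Sel^φ(W) = 2`, `m = 1`, EXCESS `= 2`
(`bnfcertify` 1/1 / 1/1, isogcft duality PASS/PASS); Mordell–Weil part of `Sel^φ(W)` = `1` (`Ê(ℚ)_tors ≅ ℤ/3 ⊇ Ĉ(ℚ) ≅ ℤ/3` rational, `#W(ℚ)_tors = 1`, rank `0`: `Ê(ℚ)/φW(ℚ) ≅ ℤ/3`) ⟹ **`dim Ш(W)[φ] = 1`**, `Ш(W)[3] ⊇ Ш(W)[φ] ≠ 0`.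
LOWER half only; per row; NOT a class theorem; nothing booked; BSD is not proved by any of this.
[cite: SilvermanAEC2009, Thm. X.4.14 and Ex. 3.7] [cite: SchaeferStoll2004] [cite: Cremona1997, Table 1 (label 402534h1)] [cite: Miller2011LMS, Def. 1.1] -/
theorem gordTwoLower_isog_i402534h1_3
    (hCT : exists_casselsTate_pairing (K := ℚ)) (hGZK : rank_eq_analyticRank_of_analyticRank_le_one)
    {W : WeierstrassCurve ℚ} [W.IsElliptic] [W.IsGloballyMinimal] (hWeq : W = ⟨1, -1, 0, 2322, -22572⟩)
    (hr0 : W.analyticRank = 0) {q : ℚ} (hq : shaAn W = (q : ℂ)) (hv : padicValRat 3 q ≤ 2)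
    (hx : ∃ x : W.sha, x ≠ 0 ∧ 3 • x = 0) :
    N10.CellGordTwo W 3 ∧ ¬ W.HasIrreducibleModPGaloisRep 3 ∧ MissingLowerBoundAt W 3 := by
  haveI : Fact (Nat.Prime 3) := ⟨by norm_num⟩
  haveI := isElliptic_iV402534h1
  haveI := isGloballyMinimal_iV402534h1
  have hIW : integralModelInt W = (⟨1, -1, 0, 2322, -22572⟩ : WeierstrassCurve ℤ) :=
    integralModelInt_eq_of_map_eq _ (by rw [hWeq]; ext <;> simp [WeierstrassCurve.map])
  have hadd : Addv W 3 := Additive.addv_of_intModel hIW 3 (by decide +kernel) (by decide +kernel)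
  have hj : 0 ≤ padicValRat 3 W.j := padicValRat_j_nonneg_of_intModel hIW 3 2 (by decide +kernel) (by decide +kernel)
  have hWV : (⟨1, (0 : ℚ), ((1 : ℚ) / 2), (0 : ℚ)⟩ : VariableChange ℚ) • (⟨1, 0, 0, 258, 836⟩ : WeierstrassCurve ℚ).quadraticTwist (-((3 : ℕ) : ℚ)) = W := by
    rw [hWeq]
    ext <;> simp [WeierstrassCurve.variableChange_a₁, WeierstrassCurve.variableChange_a₂,
      WeierstrassCurve.variableChange_a₃, WeierstrassCurve.variableChange_a₄, WeierstrassCurve.variableChange_a₆,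
      WeierstrassCurve.quadraticTwist, WeierstrassCurve.b₂, WeierstrassCurve.b₄, WeierstrassCurve.b₆] <;> norm_num
  have hG : TypeGOrd W 3 :=
    (typeGOrd_or_padicValRat_j_neg_of_twist_neg W 3 (by norm_num) (⟨1, 0, 0, 258, 836⟩ : WeierstrassCurve ℚ) ⟨_, hWV⟩
      (Or.inl goodOrd3_iV402534h1)).resolve_right (not_lt.mpr hj)
  have he : semistabilityIndex W 3 = 2 := by
    rw [semistabilityIndex, minimalDiscriminantInt_eq hIW, intCurve_Δ]; decide +kernel
  have hred : ¬ W.HasIrreducibleModPGaloisRep 3 := by rw [hWeq]; exact not_irreducible_i402534h1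
  exact ⟨⟨by norm_num, hadd, hG, he⟩, hred,
    missingLowerBoundAt_of_casselsTate_of_pow_dvd W 3 hCT (hGZK W (by rw [hr0]; norm_num)).2 hq (k := 1)
      (by simpa using hv) (by simpa using dvd_shaOrder_of_exists_torsion W 3 hx)⟩

/-- **L₀ = `ord_3 #Ш_an ≤ ord_3 #Ш` for `402534h1`** — the crux's conclusion `MissingLowerBoundAt W 3` on this `stub_reducibleNoCaseOne` row, from
`gordTwoLower_isog_i402534h1_3` (same binders). Per row; nothing booked. [cite: SilvermanAEC2009, Thm. X.4.14] [cite: Miller2011LMS, Def. 1.1] -/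
theorem missingLowerBoundAt_i402534h1_3
    (hCT : exists_casselsTate_pairing (K := ℚ)) (hGZK : rank_eq_analyticRank_of_analyticRank_le_one)
    {W : WeierstrassCurve ℚ} [W.IsElliptic] [W.IsGloballyMinimal] (hWeq : W = ⟨1, -1, 0, 2322, -22572⟩)
    (hr0 : W.analyticRank = 0) {q : ℚ} (hq : shaAn W = (q : ℂ)) (hv : padicValRat 3 q ≤ 2)
    (hx : ∃ x : W.sha, x ≠ 0 ∧ 3 • x = 0) : MissingLowerBoundAt W 3 :=
  (gordTwoLower_isog_i402534h1_3 hCT hGZK hWeq hr0 hq hv hx).2.2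

end Summit.BirchSwinnertonDyer.BirchSwinnertonDyer.Theorems.AdditiveBranchIMCGordTwoRankZeroIsogenyDescent

end
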